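import Summits.CriticalPhenomena.PercolationContinuityZ3.Theorems.Transplant.AutEndStateFC
import Summits.CriticalPhenomena.PercolationContinuityZ3.Theorems.Transplant.AutEndStateCayley
import Mathlib.GroupTheory.SemidirectProduct
import HarnessLib

/-!
# The FC-split end state ON CAYLEY GRAPHS, by name: `θ(p_c) = 0` and `p_c < 1` on every Cayley graph of every finitely generated group with a
# FINITE-INDEX subgroup carrying two independent characters and a central element they do not kill — in particular on every Cayley graph of every group
# VIRTUALLY `K × ℤ^d` (`d ≥ 2`, `K` ANY group: intermediate growth allowed), e.g. `K × P` with `P` crystallographic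

builds on p205010 (kernel theorem, internal audit signed; external expert review pending).  Lane `prim-bschramm`, seat `prim-bschramm-gen-1` gen 7 (GEN pen,
p3 lineage), CUSTOMERS of the design owner p3-g32's covering-route theorem «AutEndStateFC» (`AutCyl.conj4_of_orbitDatum_central`, RULING L-Q3-2).  Helper file
(`--supports stmt-CriticalPhenomena-4575 --as helper`); def-free; unconditional.  NOTHING is claimed about the `@[conjecture]` `BenjaminiSchramm1996_conj4_endState`:
only its central / FC-split sub-case is used, exactly as landed in «AutEndStateFC».

WHAT IS ALREADY IN THE TREE (and NOT restated here): with the characters on `Γ` ITSELF (`b₁(Γ) ≥ 2`) no central element is needed — the one-type node `U_s` gives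
`θ(p_c) = 0` on every Cayley graph of `Γ` («SkeletonFrmScaled1CustomersHoldsA» `CayleyScaled.criticalContinuity_of_two_characters_holds`, `…_of_rank_holds`,
`…_of_surjective'_holds`, `…_prod_zTwo_holds` — `K × ℤ²` for every `K` included).  WHAT THIS FILE ADDS is the VIRTUAL datum: the characters live on a FINITE-INDEX
subgroup `Γ₀` (so left translation by `Γ₀` has finitely many orbits — the end-state class, out of the one-type node's reach), at the price of a `Γ₀`-central element
they do not kill (p3-g32's FC hypothesis, which discharges the quasi-step node's cylinder hypothesis by the Martineau–Severo covering route).  Reached for the first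
time by name: Cayley graphs of groups virtually `K × ℤ^d` with `b₁ ≤ 1`, e.g. `K × P` with `P` crystallographic of trivial `b₁` and `K` of intermediate growth
(neither virtually nilpotent nor of exponential growth).

* §1 `EndStateCayley.exists_inputFC_of_vb1` — p4-g27's end-state input on `Cay(Γ; S)` («AutEndStateCayley» `exists_input_of_vb1`: the left translations
  `L(Γ₀)`, character `c = (ψ₀, ψ₁) ∘ L⁻¹`) with the FC datum EXPOSED: `z ∈ Γ₀` commuting with `Γ₀`, `(ψ₀ z, ψ₁ z) ≠ 0`, gives `g = L z ∈ A₀` with `c g ≠ 1`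
  central in `A₀`.
* §2 `EndStateCayley.conj4_cayley_of_vb1_central` — hence, by «AutEndStateFC», `p_c < 1 ∧ θ_g(p_c) = 0` at every vertex of every Cayley graph of such a `Γ`;
  `conj4_cayley_of_central_pair` — p3-g32's central-pair signature (RULING W-2) as a corollary.
* §3 `conj4_cayley_of_virtually_prod_zd` (an injective `K × ℤ^d → Γ` with finite-index image, `d ≥ 2`, `K` any group), `conj4_cayley_prod_of_virtuallyZd`
  (`K × P`, `P` virtually `ℤ^d`, `d ≥ 2` — every crystallographic `P`) `conj4_cayley_prod_semidirect_zd` (`K × (ℤ^d ⋊ F)`, `F` finite, any action) and `conj4_cayley_semidirect_prod_zd` (`(K × ℤ^d) ⋊ F`, `F` finite, any action —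
  the characters need not extend).
[cite: BenjaminiSchramm1996, Conj. 4; §2 (Cayley graphs; almost transitive graphs)] [cite: MartineauSevero2019, Cor. 2.2] [cite: Hutchcroft2016, Thm. 1.1]
-/

noncomputable section

namespace Summit.CriticalPhenomena.PercolationContinuityZ3.Theorems.Transplant

open SimpleGraph Literature.Barriers.CriticalPhenomena Literature.Probability.LatticeModels Literature.Probability.Percolation
open scoped Classical

namespace EndStateCayley

variable {Γ : Type} [Group Γ]

/-! ## §1 The end-state input on a Cayley graph with its FC datum exposed -/

/-- **`vb₁(Γ) ≥ 2` with a central surviving element ⟹ the FC-split end-state input on every Cayley graph of `Γ`**: `Γ₀ ≤ Γ` of finite index with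
independent characters `ψ₀, ψ₁` and `z ∈ Γ₀` commuting with `Γ₀`, `(ψ₀ z, ψ₁ z) ≠ 0`, give on `Cay(Γ; S)` (ANY finite `S`) the subgroup `A₀ = L(Γ₀) ≤ Aut` of left
translations (finitely many orbits = right cosets; free), the rank-two character `c = (ψ₀, ψ₁) ∘ L⁻¹` killing every (trivial) stabiliser, and the element
`g = L z ∈ A₀` with `c g ≠ 1` CENTRAL in `A₀` (construction adapted from «AutEndStateCayley» `exists_input_of_vb1`, p4-g27).
[cite: BenjaminiSchramm1996, §2 (Cayley graphs)] [cite: GrimmettLi2017Amenability, Prop. 18] -/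
theorem exists_inputFC_of_vb1 (S : Finset Γ) (Γ₀ : Subgroup Γ) [Γ₀.FiniteIndex] (ψ₀ ψ₁ : Γ₀ →* Multiplicative ℤ) (a b : Γ₀)
    (hind : Multiplicative.toAdd (ψ₀ a) * Multiplicative.toAdd (ψ₁ b) ≠ Multiplicative.toAdd (ψ₁ a) * Multiplicative.toAdd (ψ₀ b))
    (z : Γ₀) (hz : ∀ h : Γ₀, h * z = z * h) (hψz : ψ₀ z ≠ 1 ∨ ψ₁ z ≠ 1) :
    ∃ (A₀ : Subgroup (mulCayley (↑S : Set Γ) ≃g mulCayley (↑S : Set Γ))) (reps : Finset Γ) (c : A₀ →* Multiplicative (Site 2)),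
      (∀ w : Γ, ∃ x : A₀, ∃ s ∈ reps, (x : mulCayley (↑S : Set Γ) ≃g mulCayley (↑S : Set Γ)) s = w) ∧
      (∀ (x : A₀) (w : Γ), (x : mulCayley (↑S : Set Γ) ≃g mulCayley (↑S : Set Γ)) w = w → c x = 1) ∧
      (∃ x y : A₀, MaxArea.det2 (Multiplicative.toAdd (c x)) (Multiplicative.toAdd (c y)) ≠ 0) ∧
      ∃ g : A₀, c g ≠ 1 ∧ ∀ x : A₀, x * g = g * x := by
  -- adapted from «AutEndStateCayley» `exists_input_of_vb1` (p4-g27): left translations as a homomorphism into `Aut(Cay(Γ; S))`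
  let L : Γ →* (mulCayley (↑S : Set Γ) ≃g mulCayley (↑S : Set Γ)) :=
    { toFun := leftMulIso S
      map_one' := RelIso.ext fun x => by show (1 : Γ) * x = x; exact one_mul x
      map_mul' := fun g h => RelIso.ext fun x => by show g * h * x = g * (h * x); exact mul_assoc g h x }
  have hL : ∀ g w : Γ, L g w = g * w := fun g w => rfl
  have hLinj : Function.Injective L := fun g h hgh => by
    have h1 := congrArg (fun e : mulCayley (↑S : Set Γ) ≃g mulCayley (↑S : Set Γ) => e 1) hgh
    simpa only [hL, mul_one] using h1
  set A₀ : Subgroup (mulCayley (↑S : Set Γ) ≃g mulCayley (↑S : Set Γ)) := Γ₀.map L with hA₀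
  let e : Γ₀ ≃* A₀ := Γ₀.equivMapOfInjective L hLinj
  have he : ∀ h : Γ₀, ((e h : A₀) : mulCayley (↑S : Set Γ) ≃g mulCayley (↑S : Set Γ)) = L h := fun h =>
    Subgroup.coe_equivMapOfInjective_apply Γ₀ L hLinj h
  let c : A₀ →* Multiplicative (Site 2) := (CayleyScaled.pairHom ψ₀ ψ₁).comp e.symm.toMonoidHom
  have hc : ∀ h : Γ₀, c (e h) = CayleyScaled.pairHom ψ₀ ψ₁ h := fun h => by
    show CayleyScaled.pairHom ψ₀ ψ₁ (e.symm (e h)) = _; rw [MulEquiv.symm_apply_apply]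
  -- right coset representatives: `w = (w ρ(w)⁻¹) ρ(w)` with `w ρ(w)⁻¹ ∈ Γ₀`
  let ρ : Γ → Γ := fun w => ((QuotientGroup.mk (w⁻¹) : Γ ⧸ Γ₀).out)⁻¹
  have hρ : ∀ w : Γ, w * (ρ w)⁻¹ ∈ Γ₀ := fun w => by
    obtain ⟨k, hk⟩ := QuotientGroup.mk_out_eq_mul Γ₀ w⁻¹
    show w * (((QuotientGroup.mk (w⁻¹) : Γ ⧸ Γ₀).out)⁻¹)⁻¹ ∈ Γ₀
    rw [inv_inv, hk, mul_inv_cancel_left]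
    exact k.2
  set reps : Finset Γ := (Set.finite_range fun q : Γ ⧸ Γ₀ => (q.out)⁻¹).toFinset with hreps
  have hρmem : ∀ w, ρ w ∈ reps := fun w => by rw [hreps, Set.Finite.mem_toFinset]; exact ⟨_, rfl⟩
  refine ⟨A₀, reps, c, fun w => ?_, fun x w hxw => ?_, ?_, e z, ?_, fun x => ?_⟩
  · refine ⟨e ⟨w * (ρ w)⁻¹, hρ w⟩, ρ w, hρmem w, ?_⟩
    rw [he, hL]
    exact inv_mul_cancel_right w (ρ w)
  · -- the action is free: `x = e γ` with `γ w = w` forces `γ = 1`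
    have hx : x = e (e.symm x) := (MulEquiv.apply_symm_apply e x).symm
    have hγ : ((e.symm x : Γ₀) : Γ) = 1 := by
      have h1 : ((e (e.symm x) : A₀) : mulCayley (↑S : Set Γ) ≃g mulCayley (↑S : Set Γ)) w = w := by rw [← hx]; exact hxw
      rw [he, hL] at h1
      exact mul_eq_right.1 h1
    rw [hx, hc]
    have h1 : (e.symm x : Γ₀) = 1 := Subtype.ext hγ
    rw [h1, map_one]
  · refine ⟨e a, e b, ?_⟩
    rw [hc, hc, MaxArea.det2, CayleyScaled.toAdd_pairHom_zero, CayleyScaled.toAdd_pairHom_one, CayleyScaled.toAdd_pairHom_zero,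
      CayleyScaled.toAdd_pairHom_one]
    exact sub_ne_zero.2 hind
  · -- the character does not kill `g = L z`
    rw [hc]
    intro h
    have h0 : Multiplicative.toAdd (CayleyScaled.pairHom ψ₀ ψ₁ z) 0 = 0 := by rw [h, toAdd_one, Pi.zero_apply]
    have h1 : Multiplicative.toAdd (CayleyScaled.pairHom ψ₀ ψ₁ z) 1 = 0 := by rw [h, toAdd_one, Pi.zero_apply]
    rw [CayleyScaled.toAdd_pairHom_zero] at h0
    rw [CayleyScaled.toAdd_pairHom_one] at h1
    rcases hψz with h' | h'
    · exact h' (toAdd_eq_zero.1 h0)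
    · exact h' (toAdd_eq_zero.1 h1)
  · -- `g = L z` is central in `A₀ = L(Γ₀)`
    have hx : x = e (e.symm x) := (MulEquiv.apply_symm_apply e x).symm
    rw [hx, ← map_mul, ← map_mul, hz]

/-! ## §2 Conjecture 4 on such Cayley graphs, through the FC-split end state «AutEndStateFC» -/

/-- **`θ(p_c) = 0` and `p_c < 1` on EVERY Cayley graph of every finitely generated group with a FINITE-INDEX subgroup `Γ₀` carrying two independent
characters `ψ₀, ψ₁` and an element `z` commuting with `Γ₀` that they do not kill** — unconditional: the FC-split end state «AutEndStateFC»
(`AutCyl.conj4_of_orbitDatum_central`: quasi-step node + Martineau–Severo covering route + Hutchcroft) at the input of §1; `p_c < 1` by the rank-two character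
(«AutChartQuasiTransitive»).  Covers every group virtually of the form `K × ℤ^d`, `d ≥ 2`, `K` of ANY growth; for `Γ₀ = Γ` (`b₁(Γ) ≥ 2`) the conclusion
is already the one-type node's («SkeletonFrmScaled1CustomersHoldsA» `CayleyScaled.criticalContinuity_of_two_characters_holds`, no central element needed).
builds on p205010 (kernel theorem, internal audit signed; external expert review pending).
[cite: BenjaminiSchramm1996, Conj. 4; §2 (Cayley graphs)] [cite: MartineauSevero2019, Cor. 2.2] [cite: Hutchcroft2016, Thm. 1.1] -/
theorem conj4_cayley_of_vb1_central (S : Finset Γ) (hS : Subgroup.closure (S : Set Γ) = ⊤) (Γ₀ : Subgroup Γ) [Γ₀.FiniteIndex]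
    (ψ₀ ψ₁ : Γ₀ →* Multiplicative ℤ) (a b : Γ₀)
    (hind : Multiplicative.toAdd (ψ₀ a) * Multiplicative.toAdd (ψ₁ b) ≠ Multiplicative.toAdd (ψ₁ a) * Multiplicative.toAdd (ψ₀ b))
    (z : Γ₀) (hz : ∀ h : Γ₀, h * z = z * h) (hψz : ψ₀ z ≠ 1 ∨ ψ₁ z ≠ 1) (g : Γ) :
    criticalProb (mulCayley (↑S : Set Γ)) g < 1 ∧ theta (mulCayley (↑S : Set Γ)) g (criticalProbIOf (mulCayley (↑S : Set Γ)) g) = 0 := by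
  obtain ⟨A₀, reps, c, horb, hstab, hrank, x, hx, hcomm⟩ := exists_inputFC_of_vb1 S Γ₀ ψ₀ ψ₁ a b hind z hz hψz
  have hconn : (mulCayley (↑S : Set Γ)).Connected := CayleyScaled.connected_mulCayley_of_closure S hS
  refine ⟨?_, AutCyl.conj4_of_orbitDatum_central (mulCayley (↑S : Set Γ)) hconn A₀ reps c horb hstab hrank x hx hcomm g⟩
  have hact : IsActionByAut (mulCayley (↑S : Set Γ)) A₀ := fun a' y y' => (a' : mulCayley (↑S : Set Γ) ≃g mulCayley (↑S : Set Γ)).map_rel_iff'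
  have hcover : ∀ w : Γ, ∃ a' : A₀, ∃ s ∈ reps, a' • s = w := fun w => by
    obtain ⟨a', s, hs, hw⟩ := horb w
    exact ⟨a', s, hs, hw⟩
  exact AutChart.criticalProb_lt_one_of_finite_orbits hact hconn (1 : Γ) reps hcover c
    (fun h hh => hstab h 1 (MulAction.mem_stabilizer_iff.1 hh)) hrank g

/-- **Central-pair form** (the design owner p3-g32's §3 signature `criticalContinuity_of_central_pair`, RULING W-2, here with `p_c < 1` added): `Γ₀ ≤ Γ` of finite
index, characters `ψ₀, ψ₁` of `Γ₀` independent on a pair `z₀, z₁` with `z₀` CENTRAL in `Γ₀` ⟹ `p_c < 1 ∧ θ_g(p_c) = 0` on every Cayley graph of `Γ` (independence on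
`(z₀, z₁)` forces `(ψ₀ z₀, ψ₁ z₀) ≠ 0`, so `conj4_cayley_of_vb1_central` applies with `z = a = z₀`, `b = z₁`).
builds on p205010 (kernel theorem, internal audit signed; external expert review pending).
[cite: BenjaminiSchramm1996, Conj. 4; §2 (Cayley graphs)] [cite: MartineauSevero2019, Cor. 2.2] -/
theorem conj4_cayley_of_central_pair (S : Finset Γ) (hS : Subgroup.closure (S : Set Γ) = ⊤) (Γ₀ : Subgroup Γ) [Γ₀.FiniteIndex]
    (ψ₀ ψ₁ : Γ₀ →* Multiplicative ℤ) (z₀ z₁ : Γ₀) (hz₀ : z₀ ∈ Subgroup.center Γ₀)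
    (hind : Multiplicative.toAdd (ψ₀ z₀) * Multiplicative.toAdd (ψ₁ z₁) ≠ Multiplicative.toAdd (ψ₁ z₀) * Multiplicative.toAdd (ψ₀ z₁)) (g : Γ) :
    criticalProb (mulCayley (↑S : Set Γ)) g < 1 ∧ theta (mulCayley (↑S : Set Γ)) g (criticalProbIOf (mulCayley (↑S : Set Γ)) g) = 0 := by
  refine conj4_cayley_of_vb1_central S hS Γ₀ ψ₀ ψ₁ z₀ z₁ hind z₀ (fun h => (Subgroup.mem_center_iff.1 hz₀) h) ?_ g
  by_contra hψ
  rw [not_or, not_not, not_not] at hψ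
  apply hind
  rw [hψ.1, hψ.2, toAdd_one, zero_mul, zero_mul]

/-! ## §3 Named instances: groups VIRTUALLY of the form `K × ℤ^d`, `d ≥ 2` — in particular `K × P` with `P` virtually `ℤ^d` -/

/-- The `i`-th coordinate character of `ℤ^d` (written multiplicatively). [folklore] -/
private theorem toAdd_evalHom {d : ℕ} (i : Fin d) (v : Multiplicative (Fin d → ℤ)) :
    Multiplicative.toAdd ((AddMonoidHom.toMultiplicative (Pi.evalAddMonoidHom (fun _ : Fin d => ℤ) i)) v) = Multiplicative.toAdd v i := rfl

/-- **EVERY Cayley graph of every group VIRTUALLY `K × ℤ^d`, `d ≥ 2`, `K` ANY group** (an injective `ι : K × ℤ^d → Γ` with finite-index image; every finite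
generating set of `Γ`): `p_c < 1` and `θ(p_c) = 0` at every vertex.  The characters are the first two coordinates of the `ℤ^d` factor read on `ι(K × ℤ^d)`, the
element is `ι(1, e₀)`, central in the image.  `b₁(Γ)` itself may vanish (e.g. `Γ = K × P`, `P` crystallographic with `b₁(P) = 0`, `b₁(K) = 0`: not reached by the
one-type node's `b₁ ≥ 2` customers), and `K` may have intermediate growth (not virtually nilpotent, not Hutchcroft's class).
builds on p205010 (kernel theorem, internal audit signed; external expert review pending).
[cite: BenjaminiSchramm1996, Conj. 4; §2 (Cayley graphs)] [cite: MartineauSevero2019, Cor. 2.2] [cite: Hutchcroft2016, Thm. 1.1] -/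
theorem conj4_cayley_of_virtually_prod_zd {K : Type} [Group K] {d : ℕ} (hd : 2 ≤ d) (ι : K × Multiplicative (Fin d → ℤ) →* Γ)
    (hι : Function.Injective ι) [ι.range.FiniteIndex] (S : Finset Γ) (hS : Subgroup.closure (S : Set Γ) = ⊤) (g : Γ) :
    criticalProb (mulCayley (↑S : Set Γ)) g < 1 ∧ theta (mulCayley (↑S : Set Γ)) g (criticalProbIOf (mulCayley (↑S : Set Γ)) g) = 0 := by
  set i₀ : Fin d := ⟨0, by omega⟩ with hi₀
  set i₁ : Fin d := ⟨1, by omega⟩ with hi₁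
  have hne : i₁ ≠ i₀ := fun h => by
    have := congrArg Fin.val h
    rw [hi₀, hi₁] at this
    exact one_ne_zero this
  let ψ : Fin d → (Multiplicative (Fin d → ℤ) →* Multiplicative ℤ) := fun i =>
    AddMonoidHom.toMultiplicative (Pi.evalAddMonoidHom (fun _ : Fin d => ℤ) i)
  have hψ : ∀ i v, Multiplicative.toAdd (ψ i v) = Multiplicative.toAdd v i := fun i v => toAdd_evalHom i v
  let u : Fin d → Multiplicative (Fin d → ℤ) := fun i => Multiplicative.ofAdd (Pi.single i 1)
  have hu : ∀ i j, Multiplicative.toAdd (ψ i (u j)) = (Pi.single j (1 : ℤ) : Fin d → ℤ) i := fun i j => by rw [hψ]; rfl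
  -- transport along `e : K × ℤ^d ≃* ι(K × ℤ^d)`
  let e : K × Multiplicative (Fin d → ℤ) ≃* ι.range := MonoidHom.ofInjective hι
  let χ : Fin d → (ι.range →* Multiplicative ℤ) := fun i => ((ψ i).comp (MonoidHom.snd K _)).comp e.symm.toMonoidHom
  have hχ : ∀ i x, χ i (e x) = ψ i x.2 := fun i x => by
    show ψ i (e.symm (e x)).2 = _; rw [MulEquiv.symm_apply_apply]
  refine conj4_cayley_of_vb1_central S hS ι.range (χ i₀) (χ i₁) (e (1, u i₀)) (e (1, u i₁)) ?_ (e (1, u i₀)) (fun h => ?_) (Or.inl ?_) g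
  · rw [hχ, hχ, hχ, hχ]
    show Multiplicative.toAdd (ψ i₀ (u i₀)) * Multiplicative.toAdd (ψ i₁ (u i₁)) ≠
      Multiplicative.toAdd (ψ i₁ (u i₀)) * Multiplicative.toAdd (ψ i₀ (u i₁))
    rw [hu, hu, hu, hu, Pi.single_eq_same, Pi.single_eq_same, Pi.single_eq_of_ne hne, Pi.single_eq_of_ne hne.symm]
    norm_num
  · obtain ⟨x, rfl⟩ := e.surjective h
    rw [← map_mul, ← map_mul]
    congr 1
    exact Prod.ext (by show x.1 * 1 = 1 * x.1; rw [mul_one, one_mul]) (mul_comm x.2 _)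
  · rw [hχ]
    intro h
    have h1 : Multiplicative.toAdd (ψ i₀ (u i₀)) = 0 := by
      have h' : ψ i₀ (u i₀) = 1 := h
      rw [h', toAdd_one]
    rw [hu, Pi.single_eq_same] at h1
    exact one_ne_zero h1

/-- **EVERY Cayley graph of `K × P` for every group `K` and every group `P` VIRTUALLY `ℤ^d`, `d ≥ 2`** (an injective `ℤ^d → P` with finite-index image — every
crystallographic group `P` in dimension `d ≥ 2`, any point group): `p_c < 1` and `θ(p_c) = 0` at every vertex, every finite generating set of the product.
`K` of ANY growth; `b₁(K × P) = b₁(K) + b₁(P)` may be `0`.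
builds on p205010 (kernel theorem, internal audit signed; external expert review pending).
[cite: BenjaminiSchramm1996, Conj. 4; §2 (Cayley graphs)] [cite: MartineauSevero2019, Cor. 2.2] [cite: Hutchcroft2016, Thm. 1.1] -/
theorem conj4_cayley_prod_of_virtuallyZd {K P : Type} [Group K] [Group P] {d : ℕ} (hd : 2 ≤ d) (ι : Multiplicative (Fin d → ℤ) →* P)
    (hι : Function.Injective ι) [hfi : ι.range.FiniteIndex] (S : Finset (K × P)) (hS : Subgroup.closure (S : Set (K × P)) = ⊤) (g : K × P) :
    criticalProb (mulCayley (↑S : Set (K × P))) g < 1 ∧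
      theta (mulCayley (↑S : Set (K × P))) g (criticalProbIOf (mulCayley (↑S : Set (K × P))) g) = 0 := by
  have hinj : Function.Injective ((MonoidHom.id K).prodMap ι) := fun x y h => by
    have h' : (x.1, ι x.2) = (y.1, ι y.2) := h
    exact Prod.ext (congrArg Prod.fst h' :) (hι (congrArg Prod.snd h' :))
  haveI : ((MonoidHom.id K).prodMap ι).range.FiniteIndex := by
    rw [MonoidHom.range_prodMap, MonoidHom.range_eq_top.2 Function.surjective_id]
    refine ⟨?_⟩
    rw [Subgroup.index_prod, Subgroup.index_top, one_mul]
    exact hfi.1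
  exact conj4_cayley_of_virtually_prod_zd hd ((MonoidHom.id K).prodMap ι) hinj S hS g

/-- **EVERY Cayley graph of `K × (ℤ^d ⋊ F)`, `d ≥ 2`, `F` FINITE (any action `φ` of `F` on `ℤ^d`), `K` ANY group** — every split crystallographic group in the
second factor (`ℤ² ⋊ C₄`, `ℤ² ⋊ C₆`, `ℤ³ ⋊` point groups, …): `p_c < 1` and `θ(p_c) = 0` at every vertex, every finite generating set of the product.  Here
`b₁(ℤ^d ⋊ F)` may vanish, so with `b₁(K) = 0` (e.g. `K` a torsion group of intermediate growth) the group has NO non-trivial character at all.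
builds on p205010 (kernel theorem, internal audit signed; external expert review pending).
[cite: BenjaminiSchramm1996, Conj. 4; §2 (Cayley graphs)] [cite: MartineauSevero2019, Cor. 2.2] [cite: Hutchcroft2016, Thm. 1.1] -/
theorem conj4_cayley_prod_semidirect_zd {K F : Type} [Group K] [Group F] [Finite F] {d : ℕ} (hd : 2 ≤ d)
    (φ : F →* MulAut (Multiplicative (Fin d → ℤ))) (S : Finset (K × (Multiplicative (Fin d → ℤ) ⋊[φ] F)))
    (hS : Subgroup.closure (S : Set (K × (Multiplicative (Fin d → ℤ) ⋊[φ] F))) = ⊤) (g : K × (Multiplicative (Fin d → ℤ) ⋊[φ] F)) :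
    criticalProb (mulCayley (↑S : Set (K × (Multiplicative (Fin d → ℤ) ⋊[φ] F)))) g < 1 ∧
      theta (mulCayley (↑S : Set (K × (Multiplicative (Fin d → ℤ) ⋊[φ] F)))) g
        (criticalProbIOf (mulCayley (↑S : Set (K × (Multiplicative (Fin d → ℤ) ⋊[φ] F)))) g) = 0 := by
  haveI : (SemidirectProduct.inl : Multiplicative (Fin d → ℤ) →* Multiplicative (Fin d → ℤ) ⋊[φ] F).range.FiniteIndex := ⟨by
    rw [SemidirectProduct.range_inl_eq_ker_rightHom, Subgroup.index_ker,
      MonoidHom.range_eq_top.2 SemidirectProduct.rightHom_surjective, Subgroup.card_top]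
    exact Nat.card_pos.ne'⟩
  exact conj4_cayley_prod_of_virtuallyZd hd SemidirectProduct.inl SemidirectProduct.inl_injective S hS g

/-- **EVERY Cayley graph of `(K × ℤ^d) ⋊ F`, `d ≥ 2`, `F` FINITE acting by ANY automorphisms of `K × ℤ^d`, `K` ANY group** — the extensions in which the
characters of `K × ℤ^d` need NOT extend to the whole group (`b₁` may drop below `2`): `p_c < 1` and `θ(p_c) = 0` at every vertex, every finite generating set.
The finite-index subgroup is `inl(K × ℤ^d)` (index `|F|`), the element `inl(1, e₀)`, central in `inl(K × ℤ^d)` (not necessarily in the whole group).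
builds on p205010 (kernel theorem, internal audit signed; external expert review pending).
[cite: BenjaminiSchramm1996, Conj. 4; §2 (Cayley graphs)] [cite: MartineauSevero2019, Cor. 2.2] [cite: Hutchcroft2016, Thm. 1.1] -/
theorem conj4_cayley_semidirect_prod_zd {K F : Type} [Group K] [Group F] [Finite F] {d : ℕ} (hd : 2 ≤ d)
    (φ : F →* MulAut (K × Multiplicative (Fin d → ℤ))) (S : Finset ((K × Multiplicative (Fin d → ℤ)) ⋊[φ] F))
    (hS : Subgroup.closure (S : Set ((K × Multiplicative (Fin d → ℤ)) ⋊[φ] F)) = ⊤) (g : (K × Multiplicative (Fin d → ℤ)) ⋊[φ] F) :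
    criticalProb (mulCayley (↑S : Set ((K × Multiplicative (Fin d → ℤ)) ⋊[φ] F))) g < 1 ∧
      theta (mulCayley (↑S : Set ((K × Multiplicative (Fin d → ℤ)) ⋊[φ] F))) g
        (criticalProbIOf (mulCayley (↑S : Set ((K × Multiplicative (Fin d → ℤ)) ⋊[φ] F))) g) = 0 := by
  haveI : (SemidirectProduct.inl : K × Multiplicative (Fin d → ℤ) →* (K × Multiplicative (Fin d → ℤ)) ⋊[φ] F).range.FiniteIndex := ⟨by
    rw [SemidirectProduct.range_inl_eq_ker_rightHom, Subgroup.index_ker,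
      MonoidHom.range_eq_top.2 SemidirectProduct.rightHom_surjective, Subgroup.card_top]
    exact Nat.card_pos.ne'⟩
  exact conj4_cayley_of_virtually_prod_zd hd SemidirectProduct.inl SemidirectProduct.inl_injective S hS g

end EndStateCayley

end Summit.CriticalPhenomena.PercolationContinuityZ3.Theorems.Transplant

end
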